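import Literature.Algebra.EuclideanLattices.KhotBCHTableFP
import Literature.Algebra.EuclideanLattices.KhotReduction
import HarnessLib

/-!
# Khot 2005, Lemma 4.3 (machine level): the sampled shift `s` of the BCH block is computable in polynomial time

Topic `Algebra/EuclideanLattices`, namespace `Literature.Algebra.EuclideanLattices.Khot`. Sequel of
`KhotBCHTableFP.lean` (Khot's BCH block `khotBCH` as the list matrix `khotBCHTab`, computed on codes by
`khotBCHTabFP`) towards the machine hypothesis of `gapSVP_const_isNPHardRandomized_of_prop6_of_FP_explicit` /
`Khot2005_SAT_randReducible_gapSVP_of_prop6_of_FP_explicit` (`KhotExplicitReduction.lean`,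
`KhotSVPHardnessProofs.lean`). The base basis of Khot's instance (`khotMain`) carries, next to the block
`P = khotBCH u σ K k`, the **sampled shift** `s' = tupleShift P g` of Lemma 4.3 ("Pick `r` columns of the
matrix `P_BCH` at random and define `s` to be their sum [over `GF(2)`]"), where the tuple of columns
`g = gOf u σ K k c` is read off the coin string `c` (`coinDecode`, `KhotReduction.lean`: column `i < 31K`
is the little-endian value of coin block `i` of width `M`). This file writes `s'` as a list program and
proves it correct and polynomial-time:

* `gVals K M c` — the `31K` column indices as naturals (`gVals_eq`: item `i` is `(gOf u σ K k c i : ℕ)`);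
* `shiftVal N P G row = (Σ_{j<N, j ∈ G} ent P row j) mod 2`, `shiftTab h N P G` (rows `< h`), and
  **`getD_khotShiftTab`**: row `l + (M+1)·s` of `khotShiftTab u σ K k c := shiftTab hh NN khotBCHTab (gVals …)`
  IS `tupleShift (khotBCH u σ K k) (gOf u σ K k c) (s, l)` (the indicator of the IMAGE of `g` is
  membership in the value list, so repeated columns count once, as in `tupleShift`);
* `gValsFP`, `shiftValFP`, `shiftTabFP`, **`khotShiftTabFP`**: `((1ᴷ, (1ᴹ, 1ᴺ)), c) ↦
  shiftTab (20K(M+1)) N (bchTabAlg (20K) M N) (gVals K M c)` is computed on codes by a polynomial-time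
  string function (typed algebra `CodeFP`).

All proved; no facts.

## References

* S. Khot, *Hardness of approximating the shortest vector problem in lattices*, J. ACM 52 (2005)
  789–808, Lemma 4.3 (proof), §5.2.2, §7.3.
* S. Arora, B. Barak, *Computational Complexity: A Modern Approach*, CUP 2009, §1.3.
-/

namespace Literature.Algebra.EuclideanLattices.Khot

open Params Finset Matrix
open Literature.Computability.Complexity Literature.Computability.Complexity.CodeFP
  Literature.Computability.Complexity.LMat
open Literature.InformationTheory.Coding.GF2X (bchTabAlg)

/-! ### The list programs -/

/-- The `31K` sampled column indices, as naturals: item `i` is the little-endian value of coin block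
`i` of width `M`. [cite: Khot2005, Lemma 4.3 (proof)] -/
def gVals (K M : ℕ) (c : List Bool) : List ℕ :=
  (List.range (31 * K)).map fun i => bitsToNat (block M c i)

/-- One entry of the sampled shift: the parity of the entries of row `row` of `P` in the sampled
columns (membership in the value list `G`, so that repeated columns count once). [cite: Khot2005, Lemma 4.3 (proof)] -/
def shiftVal (N : ℕ) (P : List (List ℤ)) (G : List ℕ) (row : ℕ) : ℤ :=
  (sumRange N fun j => if decide (j ∈ G) then ent P row j else 0) % 2

/-- The sampled shift as a list over the rows `< h`. [cite: Khot2005, Lemma 4.3 (proof)] -/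
def shiftTab (h N : ℕ) (P : List (List ℤ)) (G : List ℕ) : List ℤ :=
  (List.range h).map (shiftVal N P G)

/-- **Khot's sampled shift as a program**: rows `hh = 20K(M+1)` (order `l + (M+1)s`), columns `NN`,
the BCH table `khotBCHTab`, the sampled columns `gVals`. [cite: Khot2005, Lemma 4.3 and §5.2.2] -/
def khotShiftTab (u σ K k : ℕ) (c : List Bool) : List ℤ :=
  shiftTab (hh u σ K k) (NN u σ K k) (khotBCHTab u σ K k) (gVals K (MM u σ K k) c)

/-! ### Correctness -/

/-- `gVals` lists the values of `gOf`. [cite: Khot2005, Lemma 4.3 (proof)] -/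
theorem gVals_eq (u σ K k : ℕ) (c : List Bool) :
    gVals K (MM u σ K k) c = (List.range (31 * K)).map fun i => bitsToNat (block (MM u σ K k) c i) := rfl

/-- Length of `gVals`. [folklore] -/
theorem length_gVals (K M : ℕ) (c : List Bool) : (gVals K M c).length = 31 * K := by simp [gVals]

/-- Membership in `gVals` is membership in the image of `gOf`. [cite: Khot2005, Lemma 4.3 (proof)] -/
theorem mem_gVals_iff (u σ K k : ℕ) (c : List Bool) (j : Fin (NN u σ K k)) :
    (j : ℕ) ∈ gVals K (MM u σ K k) c ↔ j ∈ (univ : Finset (Fin (31 * K))).image (gOf u σ K k c) := by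
  simp only [gVals, List.mem_map, List.mem_range, mem_image, mem_univ, true_and]
  constructor
  · rintro ⟨i, hi, hij⟩
    exact ⟨⟨i, hi⟩, Fin.ext hij⟩
  · rintro ⟨i, hij⟩
    exact ⟨i, i.isLt, by rw [← hij]; rfl⟩

/-- Length of `shiftTab`. [folklore] -/
theorem length_shiftTab (h N : ℕ) (P : List (List ℤ)) (G : List ℕ) : (shiftTab h N P G).length = h := by
  simp [shiftTab]

/-- Entries of `shiftTab`. [folklore] -/
theorem getD_shiftTab {h : ℕ} (N : ℕ) (P : List (List ℤ)) (G : List ℕ) {row : ℕ} (hrow : row < h) :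
    (shiftTab h N P G).getD row 0 = shiftVal N P G row := by
  rw [shiftTab, List.getD_eq_getElem _ _ (by simpa using hrow)]
  simp

/-- **`shiftVal` on a table of `P` is `tupleShift P g`**: for a matrix `P` with row index `ρ` stored in
row `i` of the table `T` (`ent T i j = P ρ j` for all `j < N`) and a value list `G` whose members below
`N` are exactly the values of the image of `g`, the program returns `tupleShift P g ρ`.
[cite: Khot2005, Lemma 4.3 (proof)] -/
theorem shiftVal_eq_tupleShift {H : Type} {N rr : ℕ} (P : Matrix H (Fin N) ℤ) (T : List (List ℤ))
    (g : Fin rr → Fin N) (G : List ℕ) (ρ : H) (i : ℕ) (hT : ∀ j : Fin N, ent T i j = P ρ j)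
    (hG : ∀ j : Fin N, (j : ℕ) ∈ G ↔ j ∈ (univ : Finset (Fin rr)).image g) :
    shiftVal N T G i = tupleShift P g ρ := by
  unfold shiftVal tupleShift
  congr 1
  rw [sumRange_eq_sum]
  simp only [mulVec, dotProduct, indicator]
  refine Finset.sum_congr rfl fun j _ => ?_
  by_cases hj : j ∈ (univ : Finset (Fin rr)).image g
  · have hjG : (j : ℕ) ∈ G := (hG j).2 hj
    simp [hj, hjG, hT j]
  · have hjG : (j : ℕ) ∉ G := fun h => hj ((hG j).1 h)
    simp [hj, hjG]

/-- **The program computes Khot's sampled shift**: row `l + (M+1)·s` of `khotShiftTab u σ K k c` is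
`tupleShift (khotBCH u σ K k) (gOf u σ K k c) (s, l)`. [cite: Khot2005, Lemma 4.3 and §5.2.2] -/
theorem getD_khotShiftTab (u σ K k : ℕ) (c : List Bool) (s : Fin (20 * K)) (l : Fin (MM u σ K k + 1)) :
    (khotShiftTab u σ K k c).getD ((l : ℕ) + (MM u σ K k + 1) * s) 0 =
      tupleShift (khotBCH u σ K k) (gOf u σ K k c) (s, l) := by
  have hrow : (l : ℕ) + (MM u σ K k + 1) * s < hh u σ K k := by
    have := (finProdFinEquiv (s, l)).isLt
    rw [finProdFinEquiv_apply_val] at this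
    unfold hh
    exact this
  rw [khotShiftTab, getD_shiftTab _ _ _ hrow]
  exact shiftVal_eq_tupleShift (khotBCH u σ K k) (khotBCHTab u σ K k) (gOf u σ K k c) _ (s, l) _
    (fun j => ent_khotBCHTab u σ K k s l j) (mem_gVals_iff u σ K k c)

/-- The same through `finProdFinEquiv`. [cite: Khot2005, Lemma 4.3 and §5.2.2] -/
theorem getD_khotShiftTab' (u σ K k : ℕ) (c : List Bool) (sl : Fin (20 * K) × Fin (MM u σ K k + 1)) :
    (khotShiftTab u σ K k c).getD (finProdFinEquiv sl) 0 = tupleShift (khotBCH u σ K k) (gOf u σ K k c) sl := by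
  obtain ⟨s, l⟩ := sl
  rw [finProdFinEquiv_apply_val]
  exact getD_khotShiftTab u σ K k c s l

/-- Length of `khotShiftTab`: `hh` rows. [folklore] -/
theorem length_khotShiftTab (u σ K k : ℕ) (c : List Bool) : (khotShiftTab u σ K k c).length = hh u σ K k :=
  length_shiftTab _ _ _ _

/-! ### Polynomial time -/

/-- **The sampled column indices on codes**: `((1ᴷ, 1ᴹ), c) ↦ gVals K M c` — a loop over `[0, 31K)`
of coin-block values (`block` read by `take`/`drop` with unary amounts). [cite: Khot2005, Lemma 4.3; AroraBarak2009, §1.3] -/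
theorem gValsFP : CodeFP (pairE (pairE unE unE) strE) (rawE natE) (fun p => gVals p.1.1 p.1.2 p.2) := by
  -- `1^{31K}` from `1ᴷ`
  have h31 : CodeFP (pairE (pairE unE unE) strE) unE (fun p => 31 * p.1.1) :=
    ((ulength unitE).comp (unitsMul.comp ((const _ (List.replicate 31 ())).pair
      (replicateUnit.comp (fst _ _).fst')))).congr fun p => by simp
  -- the block: context `((1^{31K}, 1ᴹ), c)`, item `i` (binary, converted to unary under the budget `31K`)
  have hmulU : CodeFP (pairE (pairE (pairE unE unE) strE) natE) unE (fun t => min t.2 t.1.1.1 * t.1.1.2) :=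
    ((ulength unitE).comp (unitsMul.comp ((replicateUnit.comp (unOfNatMin.comp ((fst _ _).fst'.fst'.pair (snd _ _)))).pair
      (replicateUnit.comp (fst _ _).fst'.snd')))).congr fun t => by simp
  have hblock : CodeFP (pairE (pairE (pairE unE unE) strE) natE) natE
      (fun t => bitsToNat (((t.1.2.drop (min t.2 t.1.1.1 * t.1.1.2))).take t.1.1.2)) :=
    strVal.comp (strTake.comp ((fst _ _).fst'.snd'.pair (strDrop.comp (hmulU.pair (fst _ _).snd'))))
  have hmap := (map hblock).comp ((((h31.pair (fst _ _).snd').pair (snd _ _))).pair (urange.comp h31))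
  refine hmap.congr fun p => ?_
  simp only [gVals, block]
  refine List.map_congr_left fun i hi => ?_
  rw [List.mem_range] at hi
  rw [min_eq_left hi.le]

/-- **One shift entry on codes**: `(((1ᴺ, P), G), row) ↦ shiftVal N P G row` — a sum over the unary
range `[0, N)` of guarded table entries, reduced mod `2`. [cite: Khot2005, Lemma 4.3; AroraBarak2009, §1.3] -/
theorem shiftValFP : CodeFP (pairE (pairE (pairE unE matE) (rawE natE)) natE) intE
    (fun p => shiftVal p.1.1.1 p.1.1.2 p.1.2 p.2) := by
  -- the summand, context `((P, G), row)`, variable `j`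
  let cE : (List (List ℤ) × List ℕ) × ℕ → List Bool := pairE (pairE matE (rawE natE)) natE
  have hmemj : CodeFP (pairE cE natE) bitE (fun t => decide (t.2 ∈ t.1.1.2)) :=
    (mem natE_injective).comp ((snd _ _).pair (fst _ _).fst'.snd')
  have hent : CodeFP (pairE cE natE) intE (fun t => ent t.1.1.1 t.1.2 t.2) :=
    (entFP.comp ((fst _ _).fst'.fst'.pair ((fst _ _).snd'.pair (snd _ _))) :)
  have hsummand : CodeFP (pairE cE natE) intE (fun t => if decide (t.2 ∈ t.1.1.2) then ent t.1.1.1 t.1.2 t.2 else 0) :=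
    ite hmemj hent (const _ (0 : ℤ))
  have hsum := sumRangeFP hsummand
  -- `hsum : CodeFP (pairE cE unE) intE (fun p => sumRange p.2 fun j => …)`; feed `(((P, G), row), 1ᴺ)`
  have hsum' : CodeFP (pairE (pairE (pairE unE matE) (rawE natE)) natE) intE
      (fun p => sumRange p.1.1.1 fun j => if decide (j ∈ p.1.2) then ent p.1.1.2 p.2 j else 0) :=
    (hsum.comp (((((fst _ _).fst'.snd'.pair (fst _ _).snd')).pair (snd _ _)).pair (fst _ _).fst'.fst')).congr
      fun p => rfl
  -- `mod 2` as `z - 2 * (z / 2)`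
  have hdiv : CodeFP intE intE (fun z => z / 2) :=
    (intEDiv.comp ((CodeFP.id intE).pair (const intE (2 : ℤ)))).congr fun _ => rfl
  have hmul2 : CodeFP intE intE (fun z => 2 * (z / 2)) :=
    (intMul.comp ((const intE (2 : ℤ)).pair hdiv)).congr fun _ => rfl
  have hmod : CodeFP intE intE (fun z => z % 2) :=
    (intSub.comp ((CodeFP.id intE).pair hmul2)).congr fun z => by
      show z - 2 * (z / 2) = z % 2
      omega
  exact (hmod.comp hsum').congr fun p => rfl

/-- **The sampled shift on codes**: `(((1ʰ, 1ᴺ), P), G) ↦ shiftTab h N P G`. [cite: Khot2005, Lemma 4.3; AroraBarak2009, §1.3] -/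
theorem shiftTabFP : CodeFP (pairE (pairE (pairE unE unE) matE) (rawE natE)) (rawE intE)
    (fun p => shiftTab p.1.1.1 p.1.1.2 p.1.2 p.2) := by
  have hmap := (map shiftValFP).comp
    (((((fst _ _).fst'.snd'.pair (fst _ _).snd').pair (snd _ _))).pair (urange.comp (fst _ _).fst'.fst'))
  exact hmap.congr fun p => rfl

/-- **Khot's sampled shift is computed on codes in polynomial time**:
`((1ᴷ, (1ᴹ, 1ᴺ)), c) ↦ shiftTab (20K(M+1)) N (bchTabAlg (20K) M N) (gVals K M c)` — so
`((1ᴷ, (1^{MM}, 1^{NN})), c) ↦ khotShiftTab u σ K k c` (`khotShiftTab_eq`). [cite: Khot2005, Lemma 4.3 and §7.3; AroraBarak2009, §1.3] -/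
theorem khotShiftTabFP : CodeFP (pairE (pairE unE (pairE unE unE)) strE) (rawE intE)
    (fun p => shiftTab (20 * p.1.1 * (p.1.2.1 + 1)) p.1.2.2 (bchTabAlg (20 * p.1.1) p.1.2.1 p.1.2.2)
      (gVals p.1.1 p.1.2.1 p.2)) := by
  -- the number of rows `20K(M+1)` in unary
  have hh' : CodeFP (pairE (pairE unE (pairE unE unE)) strE) unE (fun p => 20 * p.1.1 * (p.1.2.1 + 1)) :=
    ((ulength unitE).comp (unitsMul.comp ((unitsMul.comp ((const _ (List.replicate 20 ())).pair
      (replicateUnit.comp (fst _ _).fst'))).pair (replicateUnit.comp (unSucc.comp (fst _ _).snd'.fst'))))).congr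
      fun p => by simp
  have hP : CodeFP (pairE (pairE unE (pairE unE unE)) strE) matE (fun p => bchTabAlg (20 * p.1.1) p.1.2.1 p.1.2.2) :=
    khotBCHTabFP.comp (fst _ _)
  have hG : CodeFP (pairE (pairE unE (pairE unE unE)) strE) (rawE natE) (fun p => gVals p.1.1 p.1.2.1 p.2) :=
    gValsFP.comp (((fst _ _).fst'.pair (fst _ _).snd'.fst').pair (snd _ _))
  exact shiftTabFP.comp ((((hh'.pair (fst _ _).snd'.snd').pair hP)).pair hG)

/-- The program named: for Khot's parameters the function of `khotShiftTabFP` returns `khotShiftTab`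
(definitional unfolding, for `CodeFP.congr`). [folklore] -/
theorem khotShiftTab_eq (u σ K k : ℕ) (c : List Bool) :
    khotShiftTab u σ K k c = shiftTab (20 * K * (MM u σ K k + 1)) (NN u σ K k)
      (bchTabAlg (20 * K) (MM u σ K k) (NN u σ K k)) (gVals K (MM u σ K k) c) := rfl

end Literature.Algebra.EuclideanLattices.Khot
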